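import Literature.NumberTheory.EllipticCurves.Sprung2012.ColemanMaps
import Mathlib.Data.Nat.Choose.Lucas
import Mathlib.RingTheory.Polynomial.Basic
import HarnessLib

/-!
# Sprung 2012 Thm. 2.2 / Lemma 2.3 — the level-`2` Honda orbit modulo `p`: two binomial congruences and the abstract
# «RANK ⟹ independence of `c_{−1}` and `q`» argument (proofs only; part 1 of 2)

Topic `Literature/NumberTheory/EllipticCurves`, cluster `Sprung2012` (namespace = path). A THEOREMS file (no definition, no named
fact; net Literature debt `0`). Cell `bsd-ssimc`, width seat `cruxlead-stmt-BirchSwinnertonDyer-19875-w2` (gen 8), `--supports`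
stmt-BirchSwinnertonDyer-22569. PURPOSE: the cokernel half of (SES-KP) `0 → H¹_Iw(T) → Λ² → ℤ_p → 0` was proved in
`Sprung2012/ColemanMapJointCokernelProofs.lean` modulo the point-independence clause (IND) «`c_{−1}` and
`q = ∑_{j<p²} C(j,p)·gʲc_2 − 2∑_{j<p} j·gʲc_1` are `𝔽_p`-independent in `E(K_∞·K_v)/p`». This file and its sequel
`Sprung2012/HondaOrbitIndependenceProofs.lean` REDUCE (IND) to the natural RANK clause of F. E. I. Sprung, *Iwasawa theory for
elliptic curves at supersingular primes: A pair of main conjectures*, J. Number Theory **132** (2012) [Sprung2012], Thm. 2.2 /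
Lemma 2.3 (p. 1487: `c_n, c_{n−1}` generate the formal group `Ê(𝔪_n)`, which is `ℤ_p`-free of rank `[k_n : ℚ_p]` and has no
`p`-torsion): «no `p² − 1` points of `E(K_2·K_v)` contain the Honda orbit `{gʲc_2} ∪ {gʲc_1}` in their span modulo `p`».

## Contents
* §0 (`𝔽_p[X]`, then lifted to `ℤ[X]`): `sum_natCast_mul_X_pow_eq` — **`∑_{j<p} j·Xʲ = −(X−1)^{p−2} − (X−1)^{p−1}`** (derivative
  of `∑_{i<p} Xⁱ = (X−1)^{p−1}`); `sum_natCast_choose_mul_X_pow_eq` — **`∑_{j<p²} C(j,p)·Xʲ = −(X−1)^{p²−p−1} − (X−1)^{p²−1}`**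
  (Lucas `C(j,p) ≡ ⌊j/p⌋`, reindexing `j = pi + r`, the first identity at `X^p`, `X^p − 1 = (X−1)^p`); the `ℤ[X]` forms
  `exists_sum_natCast_mul_X_pow_eq_C_mul`, `exists_sum_natCast_choose_mul_X_pow_eq_C_mul`, `exists_X_sub_one_pow_sq_sub_eq_C_mul`.
* §1 `dvd_and_dvd_of_honda_rank` — the ABSTRACT theorem: an abelian group `M` with a `ℤ`-linear `γ`, elements `C2, C1, Cneg`
  with `γ^{p²}C2 = C2`, `γ^p C1 = C1`, the Honda relation `∑_{k<p} γᵏC1 = (a_p(a_p−2) − (p−1))·Cneg`, `p ∣ a_p`,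
  `Cneg ∉ p·M`, and the rank clause (dual form, `ℤ_p`-valued functionals) ⟹ `p·y = m₀·Cneg + m₁·q` forces `p ∣ m₀, m₁`.
  PROOF: if `p ∤ m₁`, the `γ`-stable subgroup `𝒲 = ⟨γʲC1⟩ + p·M` contains `Cneg` (Honda relation, `a_p ≡ 0`) and
  `u = ∑ C(j,p)γʲC2`; by §0, `(γ−1)^{p²−p−1}C2 + (γ−1)^{p²−1}C2 ∈ 𝒲` and `(γ−1)^{p²}C2 ∈ p·M`, whence `(γ−1)^k C2 ∈ 𝒲` for
  all `k ≥ p² − p − 1`; so the whole orbit lies in the span of the `p² − 1` elements `(γ−1)^k C2 (k < p²−p−1)`, `γʲC1 (j < p)`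
  modulo `p`, and every functional vanishing mod `p` on these vanishes mod `p` on the orbit — contradicting the rank clause.
HONEST FRAMING: elementary algebra; nothing about any curve is asserted. (Mathematically the converse also holds: (IND) ⟺ the
orbit spans `p²` dimensions mod `p`, since `⟨c̄_2⟩ ≅ 𝔽_p[N]/N^{p²−p+1}` and `⟨c̄_1⟩ ≅ 𝔽_p[N]/N^p` unconditionally.)

References: [Sprung2012] Thm. 2.2, Lemma 2.3, Cor. 2.10 (pp. 1487–1489), Def. 3.1 (p. 1489); E. Lucas (1878) via Mathlib
`Choose.choose_modEq_choose_mod_mul_choose_div`; [KuriharaPollack2007] Prop. 1.2; [LeiSujatha2021] §3 (SES-KP).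
-/

noncomputable section

open scoped Classical

open Polynomial Finset

namespace Literature.NumberTheory.EllipticCurves.Sprung2012

/-! ## §0 Two polynomial congruences modulo `p` -/

section PolyModP

variable {p : ℕ} [Fact p.Prime]

/-- `∑_{i<p} Xⁱ = (X − 1)^{p−1}` in `𝔽_p[X]` (`(X−1)^p = X^p − 1`). [folklore] -/
private theorem geom_sum_eq_X_sub_one_pow :
    ∑ i ∈ range p, (X : (ZMod p)[X]) ^ i = (X - 1) ^ (p - 1) := by
  have hp : p.Prime := Fact.out
  have h := geom_sum_mul (X : (ZMod p)[X]) p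
  have hfrob : (X : (ZMod p)[X]) ^ p - 1 = (X - 1) ^ p := by
    rw [sub_pow_char, one_pow]
  have hne : (X - 1 : (ZMod p)[X]) ≠ 0 := by
    rw [← C_1]
    exact X_sub_C_ne_zero 1
  have e : (X - 1 : (ZMod p)[X]) ^ p = (X - 1) ^ (p - 1) * (X - 1) := by
    rw [← pow_succ, Nat.sub_add_cancel hp.one_le]
  rw [hfrob, e] at h
  exact mul_right_cancel₀ hne h

/-- `(p − 1 : 𝔽_p) = −1`. [folklore] -/
private theorem natCast_pred_eq_neg_one : ((p - 1 : ℕ) : ZMod p) = -1 := by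
  have hp : p.Prime := Fact.out
  rw [Nat.cast_sub hp.one_le, Nat.cast_one, ZMod.natCast_self, zero_sub]

/-- **`∑_{j<p} j·Xʲ = −(X−1)^{p−2} − (X−1)^{p−1}` in `𝔽_p[X]`** (differentiate `∑_{i<p} Xⁱ = (X−1)^{p−1}` and multiply by
`X = (X − 1) + 1`). [folklore] -/
private theorem sum_natCast_mul_X_pow_eq :
    ∑ j ∈ range p, (C (j : ZMod p)) * (X : (ZMod p)[X]) ^ j = -(X - 1) ^ (p - 2) - (X - 1) ^ (p - 1) := by
  have hp : p.Prime := Fact.out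
  have hder := congrArg derivative (geom_sum_eq_X_sub_one_pow (p := p))
  rw [derivative_sum, show (X - 1 : (ZMod p)[X]) = X - C 1 by rw [C_1], derivative_X_sub_C_pow,
    natCast_pred_eq_neg_one, show p - 1 - 1 = p - 2 by omega] at hder
  simp only [derivative_X_pow] at hder
  -- multiply by `X`
  have hX : ∑ j ∈ range p, C (j : ZMod p) * (X : (ZMod p)[X]) ^ j =
      X * ∑ j ∈ range p, C ((j : ℕ) : ZMod p) * X ^ (j - 1) := by
    rw [mul_sum]
    refine sum_congr rfl fun j _ => ?_
    rcases Nat.eq_zero_or_pos j with rfl | hj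
    · simp
    · rw [← mul_assoc, mul_comm X, mul_assoc, ← pow_succ', Nat.sub_add_cancel hj]
  rw [hX, hder, C_neg, C_1, show (X : (ZMod p)[X]) = (X - C 1) + 1 by rw [C_1, sub_add_cancel]]
  rw [add_sub_cancel_right]
  have e : p - 1 = p - 2 + 1 := by have := hp.two_le; omega
  rw [e, pow_succ]
  ring

/-- Lucas at `k = p`: `C(j, p) ≡ ⌊j/p⌋ (mod p)`. [folklore] -/
private theorem natCast_choose_prime_eq_div (j : ℕ) : ((j.choose p : ℕ) : ZMod p) = ((j / p : ℕ) : ZMod p) := by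
  have hp : p.Prime := Fact.out
  have h := Choose.choose_modEq_choose_mod_mul_choose_div (n := j) (k := p) (p := p)
  rw [Nat.mod_self, Nat.div_self hp.pos, Nat.choose_zero_right, Nat.choose_one_right, Nat.cast_one, one_mul] at h
  have h' := (ZMod.intCast_eq_intCast_iff _ _ _).mpr h
  simpa only [Int.cast_natCast] using h'

/-- Reindexing `j = p·i + r`. [folklore] -/
private theorem sum_range_mul_eq_sum_sum {R : Type*} [AddCommMonoid R] (f : ℕ → R) (n k : ℕ) :
    ∑ j ∈ range (n * k), f j = ∑ i ∈ range k, ∑ r ∈ range n, f (n * i + r) := by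
  induction k with
  | zero => simp
  | succ k ih => rw [Nat.mul_succ, sum_range_add, ih, sum_range_succ]

/-- Exponent bookkeeping: `p(p−2) + (p−1) = p² − p − 1`. [folklore] -/
private theorem exp_aux₁ (hp : 2 ≤ p) : p * (p - 2) + (p - 1) = p ^ 2 - p - 1 := by
  obtain ⟨q, rfl⟩ : ∃ q, p = q + 2 := ⟨p - 2, by omega⟩
  rw [sq, show q + 2 - 2 = q by omega, show q + 2 - 1 = q + 1 by omega,
    show (q + 2) * (q + 2) = (q + 2) * q + 2 * q + 4 by ring]
  generalize (q + 2) * q = s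
  omega

/-- Exponent bookkeeping: `p(p−1) + (p−1) = p² − 1`. [folklore] -/
private theorem exp_aux₂ (hp : 2 ≤ p) : p * (p - 1) + (p - 1) = p ^ 2 - 1 := by
  obtain ⟨q, rfl⟩ : ∃ q, p = q + 2 := ⟨p - 2, by omega⟩
  rw [sq, show q + 2 - 1 = q + 1 by omega, show (q + 2) * (q + 2) = (q + 2) * (q + 1) + (q + 1) + 1 by ring]
  generalize (q + 2) * (q + 1) = s
  omega

/-- **`∑_{j<p²} C(j,p)·Xʲ = −(X−1)^{p²−p−1} − (X−1)^{p²−1}` in `𝔽_p[X]`**: Lucas (`C(j,p) ≡ ⌊j/p⌋`), the reindexing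
`j = p·i + r` (`= (∑_{i<p} i X^{pi})(∑_{r<p} X^r)`), the previous identity at `X^p` and `X^p − 1 = (X−1)^p`. [folklore] -/
private theorem sum_natCast_choose_mul_X_pow_eq :
    ∑ j ∈ range (p ^ 2), C ((j.choose p : ℕ) : ZMod p) * (X : (ZMod p)[X]) ^ j =
      -(X - 1) ^ (p ^ 2 - p - 1) - (X - 1) ^ (p ^ 2 - 1) := by
  have hp : p.Prime := Fact.out
  -- Lucas termwise and the reindexing
  have h1 : ∑ j ∈ range (p ^ 2), C ((j.choose p : ℕ) : ZMod p) * (X : (ZMod p)[X]) ^ j =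
      (∑ i ∈ range p, C ((i : ℕ) : ZMod p) * (X ^ p) ^ i) * ∑ r ∈ range p, X ^ r := by
    rw [sq, sum_range_mul_eq_sum_sum, sum_mul]
    refine sum_congr rfl fun i _ => ?_
    rw [mul_sum]
    refine sum_congr rfl fun r hr => ?_
    have hdiv : (p * i + r) / p = i := by
      rw [Nat.add_comm, Nat.add_mul_div_left _ _ hp.pos, Nat.div_eq_of_lt (mem_range.mp hr), zero_add]
    rw [natCast_choose_prime_eq_div, hdiv, pow_add, pow_mul, mul_assoc]
  -- the previous identity at `X^p`
  have h2 : ∑ i ∈ range p, C ((i : ℕ) : ZMod p) * ((X : (ZMod p)[X]) ^ p) ^ i =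
      -(X - 1) ^ (p * (p - 2)) - (X - 1) ^ (p * (p - 1)) := by
    have h := congrArg (Polynomial.aeval ((X : (ZMod p)[X]) ^ p)) (sum_natCast_mul_X_pow_eq (p := p))
    simp only [map_sum, map_mul, map_sub, map_neg, map_pow, aeval_C, aeval_X, map_one, Polynomial.algebraMap_eq] at h
    rw [h, show (X : (ZMod p)[X]) ^ p - 1 = (X - 1) ^ p by rw [sub_pow_char, one_pow], ← pow_mul, ← pow_mul]
  rw [h1, h2, geom_sum_eq_X_sub_one_pow, ← exp_aux₁ hp.two_le, ← exp_aux₂ hp.two_le]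
  ring

/-- A polynomial over `ℤ` that vanishes modulo `p` is `p` times a polynomial. [folklore] -/
private theorem exists_eq_C_mul_of_map_eq_zero {P : ℤ[X]} (h : P.map (Int.castRingHom (ZMod p)) = 0) :
    ∃ R : ℤ[X], P = C (p : ℤ) * R := by
  have hk : P ∈ RingHom.ker (Polynomial.mapRingHom (Int.castRingHom (ZMod p))) := h
  rw [Polynomial.ker_mapRingHom, ZMod.ker_intCastRingHom, Ideal.map_span, Set.image_singleton,
    Ideal.mem_span_singleton'] at hk
  obtain ⟨R, hR⟩ := hk
  exact ⟨R, by rw [← hR, mul_comm]⟩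

/-- `∑_{j<p} j·Xʲ + (X−1)^{p−2} + (X−1)^{p−1} ∈ p·ℤ[X]`. [folklore] -/
private theorem exists_sum_natCast_mul_X_pow_eq_C_mul :
    ∃ R : ℤ[X], ∑ j ∈ range p, (j : ℤ[X]) * X ^ j + (X - 1) ^ (p - 2) + (X - 1) ^ (p - 1) = C (p : ℤ) * R := by
  apply exists_eq_C_mul_of_map_eq_zero
  have h1 := sum_natCast_mul_X_pow_eq (p := p)
  rw [eq_sub_iff_add_eq, eq_neg_iff_add_eq_zero] at h1
  have e : (∑ j ∈ range p, (j : ℤ[X]) * X ^ j + (X - 1) ^ (p - 2) + (X - 1) ^ (p - 1)).map (Int.castRingHom (ZMod p)) =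
      ∑ j ∈ range p, C (j : ZMod p) * (X : (ZMod p)[X]) ^ j + (X - 1) ^ (p - 1) + (X - 1) ^ (p - 2) := by
    simp only [Polynomial.map_add, Polynomial.map_pow, Polynomial.map_sub, Polynomial.map_X, Polynomial.map_one,
      ← Polynomial.coe_mapRingHom, map_sum, map_mul, map_pow, map_natCast]
    simp only [Polynomial.coe_mapRingHom, Polynomial.map_X]
    rw [add_assoc, add_comm ((X - 1 : (ZMod p)[X]) ^ (p - 2)), ← add_assoc]
  rw [e, h1]

/-- `∑_{j<p²} C(j,p)·Xʲ + (X−1)^{p²−p−1} + (X−1)^{p²−1} ∈ p·ℤ[X]`. [folklore] -/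
private theorem exists_sum_natCast_choose_mul_X_pow_eq_C_mul :
    ∃ R : ℤ[X], ∑ j ∈ range (p ^ 2), ((j.choose p : ℕ) : ℤ[X]) * X ^ j + (X - 1) ^ (p ^ 2 - p - 1) +
      (X - 1) ^ (p ^ 2 - 1) = C (p : ℤ) * R := by
  apply exists_eq_C_mul_of_map_eq_zero
  have h1 := sum_natCast_choose_mul_X_pow_eq (p := p)
  rw [eq_sub_iff_add_eq, eq_neg_iff_add_eq_zero] at h1
  have e : (∑ j ∈ range (p ^ 2), ((j.choose p : ℕ) : ℤ[X]) * X ^ j + (X - 1) ^ (p ^ 2 - p - 1) +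
      (X - 1) ^ (p ^ 2 - 1)).map (Int.castRingHom (ZMod p)) =
      ∑ j ∈ range (p ^ 2), C ((j.choose p : ℕ) : ZMod p) * (X : (ZMod p)[X]) ^ j + (X - 1) ^ (p ^ 2 - 1) +
        (X - 1) ^ (p ^ 2 - p - 1) := by
    simp only [Polynomial.map_add, Polynomial.map_pow, Polynomial.map_sub, Polynomial.map_X, Polynomial.map_one,
      ← Polynomial.coe_mapRingHom, map_sum, map_mul, map_pow, map_natCast]
    simp only [Polynomial.coe_mapRingHom, Polynomial.map_X]
    rw [add_assoc, add_comm ((X - 1 : (ZMod p)[X]) ^ (p ^ 2 - p - 1)), ← add_assoc]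
  rw [e, h1]

/-- `(X−1)^{p²} − (X^{p²} − 1) ∈ p·ℤ[X]` (Frobenius). [folklore] -/
private theorem exists_X_sub_one_pow_sq_sub_eq_C_mul :
    ∃ R : ℤ[X], (X - 1 : ℤ[X]) ^ (p ^ 2) - (X ^ (p ^ 2) - 1) = C (p : ℤ) * R := by
  apply exists_eq_C_mul_of_map_eq_zero
  simp only [Polynomial.map_sub, Polynomial.map_pow, Polynomial.map_X, Polynomial.map_one]
  rw [sub_pow_char_pow, one_pow, sub_self]

end PolyModP

/-! ## §1 The abstract argument: independence of `c_{−1}` and `q` modulo `p` from a rank clause -/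

section Abstract

variable {p : ℕ} [Fact p.Prime] {M : Type*} [AddCommGroup M]

/-- **Abstract (IND) from RANK.** `M` an abelian group with a `ℤ`-linear endomorphism `γ` (= the action of `g`), elements
`C2, C1, Cneg` («`c_2, c_1, c_{−1}`») with `γ^{p²} C2 = C2`, `γ^p C1 = C1`, the Honda relation
`∑_{k<p} γᵏ C1 = (a_p(a_p−2) − (p−1))·Cneg` (`Tr_{1/0} c_1 = a_p c_0 − (p−1)c_{−1}`, `c_0 = (a_p−2)c_{−1}`), `p ∣ a_p`,
`Cneg ∉ p·M` (in the form `p·y = m·Cneg ⟹ p ∣ m`), and the RANK CLAUSE «no `p² − 1` elements of `M` contain the orbit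
`{γʲC2} ∪ {γʲC1}` in their span modulo `p`» (dual form: for every family `x : Fin (p²−1) → M` some functional `w : M →+ ℤ_p`
is `≡ 0 (mod p)` on the family and `≢ 0` somewhere on the orbit). THEN `p·y = m₀·Cneg + m₁·q` with
`q = ∑_{j<p²} C(j,p)·γʲC2 − 2∑_{j<p} j·γʲC1` forces `p ∣ m₀` and `p ∣ m₁`. Proof: if `p ∤ m₁` then, with
`𝒲 = ⟨γʲC1⟩ + p·M` (a `γ`-stable subgroup containing `Cneg`), `u = ∑ C(j,p)γʲC2 ∈ 𝒲`; the congruence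
`∑_{j<p²} C(j,p)Xʲ ≡ −(X−1)^{p²−p−1} − (X−1)^{p²−1}` and `(X−1)^{p²} ≡ X^{p²} − 1 (mod p)` give `(γ−1)^k C2 ∈ 𝒲` for all
`k ≥ p² − p − 1`, so the orbit lies in the span of the `p² − 1` elements `(γ−1)^k C2` (`k < p²−p−1`), `γʲC1` (`j < p`) modulo
`p` — contradicting the rank clause. [cite: Sprung2012, Thm. 2.2 and Lemma 2.3 (p. 1487)] -/
theorem dvd_and_dvd_of_honda_rank (γ : Module.End ℤ M) {ap : ℤ} (hap : (p : ℤ) ∣ ap) {C2 C1 Cneg : M}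
    (hC2 : (γ ^ (p ^ 2)) C2 = C2) (hC1 : (γ ^ p) C1 = C1)
    (htr1 : ∑ k ∈ range p, (γ ^ k) C1 = (ap * (ap - 2) - (p - 1)) • Cneg)
    (hcneg : ∀ (m : ℤ) (y : M), (p : ℤ) • y = m • Cneg → (p : ℤ) ∣ m)
    (hrank : ∀ x : Fin (p ^ 2 - 1) → M, ∃ w : M →+ ℤ_[p], (∀ i, (p : ℤ_[p]) ∣ w (x i)) ∧
      ((∃ j : ℕ, ¬ (p : ℤ_[p]) ∣ w ((γ ^ j) C2)) ∨ ∃ j : ℕ, ¬ (p : ℤ_[p]) ∣ w ((γ ^ j) C1)))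
    (m₀ m₁ : ℤ) (y : M)
    (hy : (p : ℤ) • y = m₀ • Cneg +
      m₁ • (∑ j ∈ range (p ^ 2), ((j.choose p : ℕ) : ℤ) • (γ ^ j) C2 - 2 • ∑ j ∈ range p, (j : ℤ) • (γ ^ j) C1)) :
    (p : ℤ) ∣ m₀ ∧ (p : ℤ) ∣ m₁ := by
  have hp : p.Prime := Fact.out
  set E := Polynomial.aeval (R := ℤ) γ with hE
  have hEX : ∀ (n : ℕ) (x : M), E (X ^ n) x = (γ ^ n) x := fun n x ↦ by rw [map_pow, aeval_X]
  have hEC : ∀ (a : ℤ) (Q : ℤ[X]) (x : M), E (C a * Q) x = a • E Q x := by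
    intro a Q x
    rw [map_mul, aeval_C, Module.End.mul_apply, Module.algebraMap_end_apply]
  have hEmul : ∀ (P Q : ℤ[X]) (x : M), E (P * Q) x = E P (E Q x) := fun P Q x ↦ by
    rw [map_mul, Module.End.mul_apply]
  set q : M := ∑ j ∈ range (p ^ 2), ((j.choose p : ℕ) : ℤ) • (γ ^ j) C2 - 2 • ∑ j ∈ range p, (j : ℤ) • (γ ^ j) C1
    with hq
  by_cases hm₁ : (p : ℤ) ∣ m₁
  · obtain ⟨m₁', rfl⟩ := hm₁
    refine ⟨hcneg m₀ (y - m₁' • q) ?_, dvd_mul_right _ _⟩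
    rw [smul_sub, hy, smul_smul, add_sub_cancel_right]
  exfalso
  -- the `γ`-stable subgroup `𝒲 = ⟨γʲ C1 : j⟩ + p·M`
  set 𝒲 : AddSubgroup M := AddSubgroup.closure
    (Set.range (fun j : Fin p ↦ (γ ^ (j : ℕ)) C1) ∪ Set.range (fun m : M ↦ (p : ℤ) • m)) with h𝒲
  have hW_p : ∀ m : M, (p : ℤ) • m ∈ 𝒲 := fun m ↦ AddSubgroup.subset_closure (Or.inr ⟨m, rfl⟩)
  have hC1pow : ∀ k : ℕ, ((γ ^ p) ^ k) C1 = C1 := by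
    intro k
    induction k with
    | zero => rw [pow_zero, Module.End.one_apply]
    | succ k ih => rw [pow_succ, Module.End.mul_apply, hC1, ih]
  have hW_C1 : ∀ j : ℕ, (γ ^ j) C1 ∈ 𝒲 := by
    intro j
    have e : (γ ^ j) C1 = (γ ^ (j % p)) C1 := by
      conv_lhs => rw [← Nat.mod_add_div j p, pow_add, pow_mul, Module.End.mul_apply, hC1pow]
    rw [e]
    exact AddSubgroup.subset_closure (Or.inl ⟨⟨j % p, Nat.mod_lt _ hp.pos⟩, rfl⟩)
  have hW_γ : ∀ x ∈ 𝒲, γ x ∈ 𝒲 := by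
    intro x hx
    refine AddSubgroup.closure_induction (p := fun x _ ↦ γ x ∈ 𝒲) ?_ ?_ ?_ ?_ hx
    · rintro x (⟨j, rfl⟩ | ⟨m, rfl⟩)
      · rw [← Module.End.mul_apply, ← pow_succ']
        exact hW_C1 _
      · rw [map_zsmul]
        exact hW_p _
    · rw [map_zero]
      exact zero_mem _
    · intro a b _ _ ha hb
      rw [map_add]
      exact add_mem ha hb
    · intro a _ ha
      rw [map_neg]
      exact neg_mem ha
  have hW_pow : ∀ (n : ℕ) (x : M), x ∈ 𝒲 → (γ ^ n) x ∈ 𝒲 := by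
    intro n
    induction n with
    | zero => intro x hx; rwa [pow_zero, Module.End.one_apply]
    | succ n ih => intro x hx; rw [pow_succ', Module.End.mul_apply]; exact hW_γ _ (ih x hx)
  have hW_E : ∀ (Q : ℤ[X]) (x : M), x ∈ 𝒲 → E Q x ∈ 𝒲 := by
    intro Q x hx
    rw [hE, Polynomial.aeval_eq_sum_range, LinearMap.sum_apply]
    refine AddSubgroup.sum_mem _ fun i _ ↦ ?_
    rw [LinearMap.smul_apply]
    exact AddSubgroup.zsmul_mem _ (hW_pow i x hx) _
  -- `Cneg ∈ 𝒲`
  have hW_Cneg : Cneg ∈ 𝒲 := by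
    obtain ⟨b, hb⟩ := hap
    have hsum : (ap * (ap - 2) - (p - 1)) • Cneg ∈ 𝒲 := by
      rw [← htr1]
      exact AddSubgroup.sum_mem _ fun k _ ↦ hW_C1 k
    have e : Cneg = (ap * (ap - 2) - (p - 1)) • Cneg - (b * (ap - 2) - 1) • ((p : ℤ) • Cneg) := by
      rw [smul_smul, ← sub_smul]
      have : (ap * (ap - 2) - (p - 1)) - (b * (ap - 2) - 1) * p = 1 := by rw [hb]; ring
      rw [this, one_smul]
    rw [e]
    exact sub_mem hsum (AddSubgroup.zsmul_mem _ (hW_p Cneg) _)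
  -- `u = ∑ C(j,p) γʲ C2 ∈ 𝒲`
  set P₂ : ℤ[X] := ∑ j ∈ range (p ^ 2), ((j.choose p : ℕ) : ℤ[X]) * X ^ j with hP₂
  have hu_eq : E P₂ C2 = ∑ j ∈ range (p ^ 2), ((j.choose p : ℕ) : ℤ) • (γ ^ j) C2 := by
    rw [hP₂, map_sum, LinearMap.sum_apply]
    refine sum_congr rfl fun j _ ↦ ?_
    rw [map_mul, map_natCast, Module.End.mul_apply, hEX, Module.End.natCast_apply, ← natCast_zsmul]
  have hu : E P₂ C2 ∈ 𝒲 := by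
    have h1 : m₁ • E P₂ C2 ∈ 𝒲 := by
      have e : m₁ • E P₂ C2 = (p : ℤ) • y - m₀ • Cneg + m₁ • (2 • ∑ j ∈ range p, (j : ℤ) • (γ ^ j) C1) := by
        rw [hy, hq, hu_eq, smul_sub]
        abel
      rw [e]
      exact add_mem (sub_mem (hW_p y) (AddSubgroup.zsmul_mem _ hW_Cneg _))
        (AddSubgroup.zsmul_mem _ (AddSubgroup.nsmul_mem _
          (AddSubgroup.sum_mem _ fun j _ ↦ AddSubgroup.zsmul_mem _ (hW_C1 j) _) _) _)
    have hpZ : Prime (p : ℤ) := Nat.prime_iff_prime_int.mp hp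
    obtain ⟨a, b, hab⟩ := (Prime.coprime_iff_not_dvd hpZ).mpr hm₁
    have e : E P₂ C2 = a • ((p : ℤ) • E P₂ C2) + b • (m₁ • E P₂ C2) := by
      rw [smul_smul, smul_smul, ← add_smul, hab, one_smul]
    rw [e]
    exact add_mem (AddSubgroup.zsmul_mem _ (hW_p _) _) (AddSubgroup.zsmul_mem _ h1 _)
  -- the polynomial congruences: `(γ − 1)^k C2 ∈ 𝒲` for `k ≥ p² − p − 1`
  set n := p ^ 2 with hn
  have hnp : p + 2 ≤ n := by rw [hn, sq]; nlinarith [hp.two_le]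
  have hp1 : 1 ≤ p := hp.one_le
  obtain ⟨R₂, hR₂⟩ := exists_sum_natCast_choose_mul_X_pow_eq_C_mul (p := p)
  obtain ⟨R₃, hR₃⟩ := exists_X_sub_one_pow_sq_sub_eq_C_mul (p := p)
  rw [← hn] at hR₂ hR₃
  have hEp : ∀ (R : ℤ[X]) (x : M), E (C (p : ℤ) * R) x ∈ 𝒲 := fun R x ↦ by rw [hEC]; exact hW_p _
  have hNsq : E ((X - 1) ^ n) C2 ∈ 𝒲 := by
    have e : (X - 1 : ℤ[X]) ^ n = (X ^ n - 1) + C (p : ℤ) * R₃ := by rw [← hR₃]; ring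
    rw [e, map_add, LinearMap.add_apply, map_sub, LinearMap.sub_apply, hEX, hC2, map_one, Module.End.one_apply,
      sub_self, zero_add]
    exact hEp _ _
  have hv : E ((X - 1) ^ (n - p - 1) + (X - 1) ^ (n - 1)) C2 ∈ 𝒲 := by
    have e : (X - 1 : ℤ[X]) ^ (n - p - 1) + (X - 1) ^ (n - 1) = C (p : ℤ) * R₂ - P₂ := by rw [← hR₂]; ring
    rw [e, map_sub, LinearMap.sub_apply]
    exact sub_mem (hEp _ _) hu
  have he2 : E ((X - 1) ^ (n - 1)) C2 ∈ 𝒲 := by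
    have epoly : (X - 1 : ℤ[X]) ^ (n - 1) =
        (X - 1) ^ p * ((X - 1) ^ (n - p - 1) + (X - 1) ^ (n - 1)) - (X - 1) ^ (p - 1) * (X - 1) ^ n := by
      rw [mul_add, ← pow_add, ← pow_add, ← pow_add, show p + (n - p - 1) = n - 1 by omega,
        show p - 1 + n = p + (n - 1) by omega]
      ring
    rw [epoly, map_sub, LinearMap.sub_apply, hEmul, hEmul]
    exact sub_mem (hW_E _ _ hv) (hW_E _ _ hNsq)
  have he1 : E ((X - 1) ^ (n - p - 1)) C2 ∈ 𝒲 := by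
    have h := sub_mem hv he2
    rwa [map_add, LinearMap.add_apply, add_sub_cancel_right] at h
  have hNk : ∀ k, n - p - 1 ≤ k → E ((X - 1) ^ k) C2 ∈ 𝒲 := by
    intro k hk
    rw [← Nat.sub_add_cancel hk, pow_add, hEmul]
    exact hW_E _ _ he1
  -- the rank clause on the family `(γ−1)^k C2 (k < n−p−1), γʲ C1 (j < p)`
  obtain ⟨w, hwx, hw⟩ := hrank (fun i ↦ if (i : ℕ) < n - p - 1 then E ((X - 1) ^ (i : ℕ)) C2
    else (γ ^ ((i : ℕ) - (n - p - 1))) C1)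
  set U : AddSubgroup M := ((Ideal.span {(p : ℤ_[p])}).toAddSubgroup).comap w with hU
  have hUmem : ∀ m, m ∈ U ↔ (p : ℤ_[p]) ∣ w m := fun m ↦ by
    rw [hU, AddSubgroup.mem_comap, Submodule.mem_toAddSubgroup, Ideal.mem_span_singleton]
  have hWU : 𝒲 ≤ U := by
    rw [h𝒲, AddSubgroup.closure_le]
    rintro x (⟨j, rfl⟩ | ⟨m, rfl⟩)
    · have hi : n - p - 1 + (j : ℕ) < n - 1 := by have := j.2; omega
      have h := hwx ⟨n - p - 1 + j, hi⟩
      simp only [show ¬ (n - p - 1 + (j : ℕ) < n - p - 1) by omega, if_false, Nat.add_sub_cancel_left] at h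
      exact (hUmem _).mpr h
    · rw [SetLike.mem_coe, hUmem, map_zsmul, zsmul_eq_mul, Int.cast_natCast]
      exact dvd_mul_right _ _
  have hUlow : ∀ k, k < n - p - 1 → E ((X - 1) ^ k) C2 ∈ U := by
    intro k hk
    have h := hwx ⟨k, by omega⟩
    simp only [hk, if_true] at h
    exact (hUmem _).mpr h
  have hUall : ∀ k, E ((X - 1) ^ k) C2 ∈ U := fun k ↦
    (Nat.lt_or_ge k (n - p - 1)).elim (hUlow k) fun hk ↦ hWU (hNk k hk)
  have hUC2 : ∀ j : ℕ, (γ ^ j) C2 ∈ U := by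
    intro j
    have e : (X : ℤ[X]) ^ j = ∑ k ∈ range (j + 1), (X - 1) ^ k * (j.choose k : ℤ[X]) := by
      have h := add_pow (X - 1 : ℤ[X]) 1 j
      simp only [one_pow, mul_one, sub_add_cancel] at h
      exact h
    rw [← hEX, e, map_sum, LinearMap.sum_apply]
    refine AddSubgroup.sum_mem _ fun k _ ↦ ?_
    rw [map_mul, map_natCast, Module.End.mul_apply, Module.End.natCast_apply, map_nsmul]
    exact AddSubgroup.nsmul_mem _ (hUall k) _
  have hUC1 : ∀ j : ℕ, (γ ^ j) C1 ∈ U := fun j ↦ hWU (hW_C1 j)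
  rcases hw with ⟨j, hj⟩ | ⟨j, hj⟩
  · exact hj ((hUmem _).mp (hUC2 j))
  · exact hj ((hUmem _).mp (hUC1 j))

end Abstract

end Literature.NumberTheory.EllipticCurves.Sprung2012

end
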